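import Summits.BirchSwinnertonDyer.Rank1Residual.O5.HeegnerLogTransportThreeHeegnerIndexEnd
import Summits.BirchSwinnertonDyer.Rank1Residual.O5.HeegnerLogTransportThreeLogUnitCertCore
import Summits.BirchSwinnertonDyer.Rank1Residual.Supersingular.RationalLadder
import Literature.NumberTheory.EllipticCurves.HeegnerPointReflectionHolds
import Literature.NumberTheory.EllipticCurves.BSDRootNumberModularityOnlyProofs
import Literature.NumberTheory.EllipticCurves.BSDHeegnerPointsModularityOnlyProofs
import HarnessLib
import HarnessLib.Audit.Tags

/-!
# Heegner-log transport at `p = 3` (KL3), part 30: the companion side INDEX-FREE — the Heegner point's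
# TRACE read against a certified rational point (`Tr_{K/ℚ} P′ ≡ n • Q₀ mod torsion`, `3 ∤ n`) replaces
# `3 ∤ [G(K) : ℤP′]` AND `P′` non-torsion; complex conjugation acts by `+1` up to torsion by Darmon's
# Prop. 3.11 (a THEOREM of the tree) at sign `w(G) = −1` — good ordinary OR supersingular companion — o5-r2 GEN 30

HONEST FRAMING (cell `b2b-bsdres`, run/shared/lean/b2b/bsd-rank1-residual/, verbatim in every file): the
goal of the cell is to DELETE the COMBINATION-SHAPED residual classes of the Birch–Swinnerton-Dyer formula
for ALL analytic-rank `≤ 1` elliptic curves over `ℚ` — "full BSD formula for every rank `≤ 1` curve in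
class `C`" assembled STRICTLY from published theorems — so that the rank-`≤ 1` remainder becomes exactly
the CONSTRUCTION-SHAPED classes, which are TYPED (missing-input `Prop`s), NOT attempted. This is not
"finishing BSD". Team O5 (tame potentially supersingular additive `p = 3`, (t′)), planner o5-r2 (the
non-Iwasawa side), GEN 30; RESEARCH ROUTE; THEOREMS ONLY (bookkeeping over explicit hypotheses): no new
node is WANTED, no Literature fact, no `@[conjecture]`, no new object; NOTHING is booked and no mark of
`RESIDUAL-MAP.md` moves. O5 OPEN.

## What this file does (memo `HOME/b2b-bsdres-o5-r2/gen30/O5-GEN30.md`)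

The Heegner-index END (part 27b `o5_index_unit_of_good_companion_heegnerIndex`, 27c its kernel ladder
certificate) still displays two EVIDENCE binders on the COMPANION side: `hP′inf : P′` has infinite order
and `hIdx : 3 ∤ [G(K) : ℤP′]` — a statement about the whole Mordell–Weil group `G(K)` (census C, o5-r2
GEN 28, kit j193386: numerical lattice identification + saturation argument). This file removes BOTH in
favour of ONE identity between three explicit points, with NO index and NO saturation claim:

* §1 `companion_logUnit_of_trace_relation` — the Ψ-line bookkeeping (X11b, Castella 2018 (calcul):
  `v(Ψ(m • x + t)) = ord₃ m + v(Ψ x)` for torsion `t`): if `m • P′ − n • Q` has finite order with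
  `3 ∤ m`, `3 ∤ n`, `Q` of infinite order and `3`-PRIMITIVE at `ι₃` in Kriz–Li's normalisation, then `P′`
  has infinite order and is `3`-primitive as well (`v(Ψ P′_ι) = v(Ψ(m • P′_ι)) = v(Ψ(n • Q_ι + t)) =
  v(Ψ Q_ι) = 0`). No index, no finiteness of anything.
* §2 the relation with `m = 2` from the TRACE: complex conjugation `σ` acts on a Heegner point `P′ ∈ G(K)`
  of level `N_G` by `σ P′ = −w(G) P′ (mod torsion)` — Darmon 2004 Prop. 3.11, PROVED in the tree
  (`heegnerPoint_conj_add_rootNumber_smul_holds`: Atkin–Lehner, Fricke, Manin–Drinfeld) — so at sign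
  `w(G) = −1` (`σ P′ − P′` torsion) the datum `hTr : P′ + σ P′ − n • Q` torsion gives `2 • P′ − n • Q`
  torsion. The sign is read either BY NAME (`hw : G.rootNumber = −1`) or from the companion's analytic
  rank `1` over `ℚ` and modularity (`rootNumber_eq_neg_one_of_analyticRank_eq_one`, bsd.S36 from `hmod`).
* §3 the END `o5_index_unit_of_good_companion_trace` = 27b §1 with `hP′inf`, `hIdx` REPLACED by
  `σ ≠ 1`, `hw`, `n`, `hn : 3 ∤ n`, `hTr`; §4 `…_trace_ladder` = §3 with the `3`-primitive rational point
  `Q₀ ∈ G(ℚ)` supplied by the tree's kernel LADDER certificate exactly as part 27c (`m • Q₀ = (x_R, y_R)`,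
  `ord₃ x_R = −2k`, `k − ord₃ m + ord₃ |G̃^{ns}(𝔽₃)| − 1 = 0`; part 24 core); §5 `…_trace_ladder_analytic` = §4 in
  ANALYTIC-RANK CURRENCY: `hPinf` from Gross–Zagier BY NAME + `ord_{s=1} L(W/K, s) = 1` (as part 28), `hw` from
  `ord_{s=1} L(G, s) = 1` (§2).

What `hTr` costs (EVIDENCE, instrument tier, census C of GEN 28 verbatim): census C identified, for the
five companions of the seven BSD-unit pairs, `Y := y_K + y_K^σ ↔ 2 Re z_K ≡ n · z(g₁) + z(t) (mod Λ_G)`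
with `g₁ =` Cremona's generator `= Q₀` of the row files and `t ∈ G(ℚ)_tors`, UNIQUE `(n, t)`, residual
`< 1.1·10⁻⁵²`: `|n| = 4, 64, 8` (16655c1/−356, 26770a1/−551, 47825d1/−344; ordinary) and `16, 32`
(2576l1/−551, 48841a1/−263; supersingular) — all prime to `3` (the sign of `n` depends on the orientation
of the parametrisation, so the rows keep `n` a binder with `3 ∤ n`). A numerical identity between three
points of `G`, re-checkable to any precision WITHOUT generators of `G(K)`; never a Literature fact.

## TYPER PLACEMENT NOTE

Place as `O5/HeegnerLogTransportThreeTraceCert.lean` AFTER part 27b (`O5/HeegnerLogTransportThreeHeegnerIndexEnd.lean`,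
IN TREE) and part 24 core (`O5/HeegnerLogTransportThreeLogUnitCertCore.lean`, IN TREE); the other imports
(`Supersingular/RationalLadder`, `Literature/…/HeegnerPointReflectionHolds`, `…/BSDRootNumberModularityOnlyProofs`)
are in the tree. THEOREMS only, namespace `Summit.BirchSwinnertonDyer.Rank1Residual.O5.HeegnerLogTransport`; no `def`.
CONTENT LABELS: THEOREMS ONLY — 0 `def`, 0 `@[conjecture]`, 0 Literature facts (net named-fact debt 0),
no `sorry`; published inputs stay displayed hypotheses BY NAME (Kriz–Li Thm. 1.16, modularity); Darmon
Prop. 3.11 is a tree THEOREM. HONEST FRAMING as above; census = EVIDENCE, never a Literature fact; O5 OPEN;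
nothing booked.

### cc-typer-5 GEN 20 (O5 §3.5 / O6 §3.4 typer of record) — by-name ask A-O5-G30-1 of o5-r2 GEN 30 (HOME/INBOX.md l.15437; by sha, VERBATIM + ¶, THEOREMS only; memo
gen30/O5-GEN30.md) item (a) f181e8a1304da1d6 → O5/HeegnerLogTransportThreeTraceCert.lean (placeable at once). Source:
`HOME/b2b-bsdres-o5-r2/gen30/lean/HeegnerLogTransportThreeTraceCert.lean` sha16 `f181e8a1304da1d6` (371 l.; `gen30/SHA16.txt`; o5-r2's farm checks rc 0 / 0 warnings / 0 sorries,
axioms standard, dedup clean as stated in their line), re-hashed by the typer right before writing; THIS file = the source VERBATIM + this paragraph (imports, module text, every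
declaration block byte-identical; script `class-closure/typer-5/gen20/gplace.py`, docstring anchor asserted); imports `O5.HeegnerLogTransportThreeHeegnerIndexEnd`,
`O5.HeegnerLogTransportThreeLogUnitCertCore`, `Supersingular.RationalLadder`, `Literature.NumberTheory.EllipticCurves.HeegnerPointReflectionHolds`,
`Literature.NumberTheory.EllipticCurves.BSDRootNumberModularityOnlyProofs`, `Literature.NumberTheory.EllipticCurves.BSDHeegnerPointsModularityOnlyProofs` — all in the tree at
filing; the typer's own standalone farm check on tree imports (rc 0 / 0 warnings / 0 sorries; `#print axioms` of the END(s) standard) and DEDUP (`lean search --decl` on the 7 new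
names: no match; the gate's statement-level dedup at dry-run) precede the proposal. CONTENT LABELS: as the source's module text above states (declarations:
`not_isOfFinAddOrder_zsmul`, `companion_logUnit_of_trace_relation`, `isOfFinAddOrder_two_zsmul_sub_of_trace`, `rootNumber_eq_neg_one_of_analyticRank_eq_one`,
`o5_index_unit_of_good_companion_trace`, `o5_index_unit_of_good_companion_trace_ladder`, `o5_index_unit_of_good_companion_trace_ladder_analytic`); 0 `@[conjecture]`, 0 Literature
facts (net named-fact debt 0), no `sorry`; published inputs stay displayed hypotheses BY NAME, nothing re-proved. HONEST FRAMING (cell `b2b-bsdres`): research route, lane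
CLASS-CLOSURE §3.5 O5; CONDITIONAL ENDs — nothing asserted beyond the displayed binders, nothing booked, no mark / label / count / tier of `RESIDUAL-MAP.md` moves; census /
instrument statements = EVIDENCE or displayed binders, never a Literature fact; O5 OPEN.
-/

set_option autoImplicit false

noncomputable section

open scoped Classical

open WeierstrassCurve Literature.NumberTheory.EllipticCurves
  Literature.NumberTheory.EllipticCurves.ModularForms
  Literature.NumberTheory.EllipticCurves.Rank1Residual
  Literature.NumberTheory.EllipticCurves.Rank1Residual.Typed
open Summit.BirchSwinnertonDyer.Rank1Residual.X11b (embAt)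
open Summit.BirchSwinnertonDyer.Rank1Residual.X11b.LocalIndex (psi
  exists_addEquiv_valuation_psi_padicPointOf valuation_psi_zsmul_add)
open Summit.BirchSwinnertonDyer.Rank1Residual.Additive.LocalLog
open IsDedekindDomain (HeightOneSpectrum)
open scoped NumberField

namespace Summit.BirchSwinnertonDyer.Rank1Residual.O5.HeegnerLogTransport

/-! ## §1 The Ψ-line bookkeeping: a torsion relation `m • P′ ≡ n • Q` with `3 ∤ m n` transports `3`-primitivity -/

/-- A multiple `n • Q`, `n ≠ 0`, of a point of infinite order has infinite order. [folklore] -/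
theorem not_isOfFinAddOrder_zsmul {A : Type*} [AddCommGroup A] {Q : A} (hQ : ¬ IsOfFinAddOrder Q)
    {n : ℤ} (hn : n ≠ 0) : ¬ IsOfFinAddOrder (n • Q) := by
  intro h
  have h' : IsOfFinAddOrder (n.natAbs • Q) := by
    have h2 := h.zsmul (i := n.sign)
    rwa [smul_smul, Int.sign_mul_self_eq_natAbs, natCast_zsmul] at h2
  exact hQ (h'.of_nsmul (Int.natAbs_ne_zero.mpr hn))

/-- **Companion-side L1♭, INDEX-FREE (GOOD prime 3; pure bookkeeping on X11b's line `Ψ`).** For `G/ℚ`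
globally minimal with good reduction at `3`, `ι₃ : K →+* ℚ₃`, and `P′, Q ∈ G(K)` with `Q` of infinite
order and `3`-PRIMITIVE at `ι₃` in Kriz–Li's normalisation (`ord₃ log_{ω_G} Q + ord₃ #G̃(𝔽₃) − 1 = 0`,
i.e. `Ψ(Q_ι)` a unit of `ℤ₃`): if `m • P′ − n • Q` has FINITE ORDER for integers `m, n` prime to `3`, then
`P′` has infinite order and is `3`-primitive too: `ord₃ log_{ω_G} P′ + ord₃ #G̃(𝔽₃) − 1 = 0`. Proof on the
line: `v(Ψ(m • P′_ι)) = ord₃ m + v(Ψ P′_ι) = v(Ψ P′_ι)` and `m • P′_ι = n • Q_ι + t` with `t` torsion, so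
`v(Ψ P′_ι) = ord₃ n + v(Ψ Q_ι) = 0` (`c₃(G) = 1` at good reduction). This REPLACES
`companion_logUnit_of_index_unit` (GEN 17: `3 ∤ [G(K) : ℤP′]`, a statement about all of `G(K)`) by a
relation between two named points. [cite: Castella2018, proof of Thm. 2.3, (calcul) (arXiv:1704.06608 p. 6)]
[cite: KrizLi2019, Rem. 1.17 (the factor `|Ẽ^{ns}(𝔽_ℓ)|/ℓ`)] -/
theorem companion_logUnit_of_trace_relation (G : WeierstrassCurve ℚ) [G.IsElliptic] [G.IsGloballyMinimal]
    (hgood : G.HasGoodReductionAtPrime 3) {K : Type} [Field K] [NumberField K] (ι₃ : K →+* ℚ_[3])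
    (P' Q : (G.baseChange K).toAffine.Point) (hQ : ¬ IsOfFinAddOrder Q)
    {m n : ℤ} (hm : ¬ (3 : ℤ) ∣ m) (hn : ¬ (3 : ℤ) ∣ n) (hrel : IsOfFinAddOrder (m • P' - n • Q))
    (hQunit : X11b.padicLogOrd G 3 ι₃ Q + padicValInt 3 (nsCount G 3) - 1 = 0) :
    ¬ IsOfFinAddOrder P' ∧ X11b.padicLogOrd G 3 ι₃ P' + padicValInt 3 (nsCount G 3) - 1 = 0 := by
  haveI : ((G.baseChange ℚ_[3]).formalFiltration 2).FiniteIndex :=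
    (G.baseChange ℚ_[3]).finiteIndex_formalFiltration 2
  have hm0 : m ≠ 0 := fun h => hm (h ▸ dvd_zero 3)
  have hn0 : n ≠ 0 := fun h => hn (h ▸ dvd_zero 3)
  -- `P′` has infinite order: else `n • Q = m • P′ − (m • P′ − n • Q)` would be torsion
  have hP' : ¬ IsOfFinAddOrder P' := by
    intro h
    apply not_isOfFinAddOrder_zsmul hQ hn0
    have h1 : IsOfFinAddOrder (m • P' - (m • P' - n • Q)) :=
      (AddCommute.all _ _).isOfFinAddOrder_add (h.zsmul) hrel.neg
    rwa [sub_sub_cancel] at h1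
  refine ⟨hP', ?_⟩
  obtain ⟨φ, hφ⟩ := exists_addEquiv_valuation_psi_padicPointOf G 3 (K := K)
  -- identifications at the good prime 3
  have hc : (G.baseChange ℚ_[3]).localTamagawaNumber ℤ_[3] = 1 :=
    localTamagawaNumber_padic_eq_one_of_good_holds G 3 hgood
  have hns : ((padicValNat 3 (reductionPointCount G 3) : ℕ) : ℤ) = padicValInt 3 (nsCount G 3) := by
    rw [nsCount_eq_reductionPointCount_of_good G 3 hgood, padicValInt.of_nat]
  -- the two points and the torsion discrepancy read in G(ℚ₃)
  have hP'ι : ¬ IsOfFinAddOrder (X11b.padicPointOf G 3 ι₃ P') := not_isOfFinAddOrder_padicPointOf G 3 ι₃ P' hP'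
  have hQι : ¬ IsOfFinAddOrder (X11b.padicPointOf G 3 ι₃ Q) := not_isOfFinAddOrder_padicPointOf G 3 ι₃ Q hQ
  have htι : IsOfFinAddOrder (m • X11b.padicPointOf G 3 ι₃ P' - n • X11b.padicPointOf G 3 ι₃ Q) := by
    have h := AddMonoidHom.isOfFinAddOrder
      (WeierstrassCurve.Affine.Point.map (W' := G) ι₃.toRatAlgHom) hrel
    simpa only [X11b.padicPointOf, map_sub, map_zsmul] using h
  have eP := hφ ι₃ P' hP'ι
  have eQ := hφ ι₃ Q hQι
  rw [hc] at eP eQ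
  have hvQ : ((psi ((G.baseChange ℚ_[3]).formalFiltration 2) φ (X11b.padicPointOf G 3 ι₃ Q)).valuation : ℤ) = 0 := by
    rw [eQ]; simp only [padicValNat_one_right, CharP.cast_eq_zero, add_zero]; rw [hns]; exact hQunit
  have ht0 : IsOfFinAddOrder (0 : (G.baseChange ℚ_[3]).toAffine.Point) :=
    (isOfFinAddOrder_iff_nsmul_eq_zero).mpr ⟨1, one_pos, by simp⟩
  -- `v(Ψ(m • P′_ι)) = ord₃ m + v(Ψ P′_ι) = v(Ψ P′_ι)`
  have h1 := valuation_psi_zsmul_add ((G.baseChange ℚ_[3]).formalFiltration 2) φ hP'ι ht0 hm0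
  -- `v(Ψ(n • Q_ι + t)) = ord₃ n + v(Ψ Q_ι) = v(Ψ Q_ι)`, `t = m • P′_ι − n • Q_ι`
  have h2 := valuation_psi_zsmul_add ((G.baseChange ℚ_[3]).formalFiltration 2) φ hQι htι hn0
  have hmap : m • X11b.padicPointOf G 3 ι₃ P' + 0 =
      n • X11b.padicPointOf G 3 ι₃ Q + (m • X11b.padicPointOf G 3 ι₃ P' - n • X11b.padicPointOf G 3 ι₃ Q) := by
    rw [add_zero, add_sub_cancel]
  rw [hmap, h2] at h1
  have h3m : padicValNat 3 m.natAbs = 0 := padicValNat.eq_zero_of_not_dvd (fun h => hm (Int.natCast_dvd.mpr h))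
  have h3n : padicValNat 3 n.natAbs = 0 := padicValNat.eq_zero_of_not_dvd (fun h => hn (Int.natCast_dvd.mpr h))
  rw [h3m, h3n, zero_add, zero_add] at h1
  have hvQ' : (psi ((G.baseChange ℚ_[3]).formalFiltration 2) φ (X11b.padicPointOf G 3 ι₃ Q)).valuation = 0 := by
    exact_mod_cast hvQ
  rw [hvQ'] at h1
  have hvP' : ((psi ((G.baseChange ℚ_[3]).formalFiltration 2) φ (X11b.padicPointOf G 3 ι₃ P')).valuation : ℤ) = 0 := by
    exact_mod_cast h1.symm
  rw [eP] at hvP'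
  simp only [padicValNat_one_right, CharP.cast_eq_zero, add_zero] at hvP'
  rw [hns] at hvP'
  exact hvP'

/-! ## §2 `m = 2` from the TRACE: Darmon's Prop. 3.11 (tree theorem) at sign `w(G) = −1` -/

/-- **`2 • P′ ≡ Tr P′` for a Heegner point at sign `−1`.** For `G/ℚ` globally minimal, `K` imaginary
quadratic with the Heegner hypothesis for `N_G`, a Heegner point `P′ ∈ G(K)` of level `N_G`, `σ ≠ 1` in
`Aut(K/ℚ)` and `w(G) = −1`: `σ P′ − P′` has finite order (Darmon 2004 Prop. 3.11, the tree THEOREM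
`heegnerPoint_conj_add_rootNumber_smul_holds`), hence for any `X ∈ G(K)`: `P′ + σ P′ − X` torsion ⟹
`2 • P′ − X` torsion. [cite: Darmon2004, Prop. 3.11 and §3.9] -/
theorem isOfFinAddOrder_two_zsmul_sub_of_trace (G : WeierstrassCurve ℚ) [G.IsElliptic] [G.IsGloballyMinimal]
    [NeZero (G.conductorNorm ℤ)] {K : Type} [Field K] [NumberField K] (hK : IsImaginaryQuadratic K)
    (hH : SatisfiesHeegnerHypothesis (G.conductorNorm ℤ) K) {P' : (G.baseChange K).toAffine.Point}
    (hP' : IsHeegnerPoint (G.conductorNorm ℤ) G K P') {σ : K →ₐ[ℚ] K} (hσ : σ ≠ AlgHom.id ℚ K)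
    (hw : G.rootNumber = -1) (X : (G.baseChange K).toAffine.Point)
    (hTr : IsOfFinAddOrder (P' + WeierstrassCurve.Affine.Point.map (W' := G) σ P' - X)) :
    IsOfFinAddOrder ((2 : ℤ) • P' - X) := by
  have hστ : IsOfFinAddOrder (WeierstrassCurve.Affine.Point.map (W' := G) σ P' - P') :=
    heegnerPoint_conj_add_rootNumber_smul.sub_isOfFinAddOrder heegnerPoint_conj_add_rootNumber_smul_holds
      hK hH hP' hσ hw
  have h := (AddCommute.all _ _).isOfFinAddOrder_add hTr hστ.neg
  have heq : P' + WeierstrassCurve.Affine.Point.map (W' := G) σ P' - X +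
      -(WeierstrassCurve.Affine.Point.map (W' := G) σ P' - P') = (2 : ℤ) • P' - X := by
    rw [two_zsmul]; abel
  rwa [heq] at h

/-- **The sign from the companion's analytic rank** (bsd.S36 from the Modularity Theorem alone, tree
`even_analyticRank_iff_rootNumber_eq_one_of_exists_isNewformOf`): `ord_{s=1} L(G, s) = 1 ⟹ w(G) = −1`.
[cite: SilvermanAEC2009, C.16 Thm. 16.3 and remark, p. 451] [cite: BCDTJAMS2001, Thm. A] -/
theorem rootNumber_eq_neg_one_of_analyticRank_eq_one (hmod : exists_isNewformOf) (G : WeierstrassCurve ℚ)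
    [G.IsElliptic] (han : G.analyticRank = 1) : G.rootNumber = -1 := by
  rcases rootNumber_eq_one_or_eq_neg_one G with h | h
  · have heven : Even G.analyticRank :=
      (even_analyticRank_iff_rootNumber_eq_one_of_exists_isNewformOf G hmod).mpr h
    rw [han] at heven
    exact absurd heven (by decide)
  · exact h

/-! ## §3 The END: 27b with the companion side INDEX-FREE -/

/-- **O5 (t′) TRACE END (o5-r2 GEN 30).** `W/ℚ` additive at `3` (`Addv W 3`) with `ρ̄_{W,3}` onto and
`3 ∤ ∏c(W)`; `G/ℚ` a mod-`3` congruent companion with GOOD reduction at `3` (ordinary or supersingular)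
and sign `w(G) = −1`; a common Heegner field `K` (`d_K < −4`, `3` split) with complex conjugation `σ ≠ 1`;
Heegner points `P ∈ W(K)` (of infinite order) and `P′ ∈ G(K)`; off-`3` depletion factors units on both
sides; Manin constants prime to `3`; a point `Q ∈ G(K)` of infinite order, `3`-primitive at `ι₃` in
Kriz–Li's normalisation; and the TRACE RELATION `P′ + σ P′ ≡ n • Q (mod torsion)` with `3 ∤ n`.
ASSUMING ONLY Kriz–Li Thm. 1.16 (`hKL`) and modularity (`hmod`) BY NAME: `3 ∤ [W(K) : ℤP]`. Compared with
27b: NO `[G(K) : ℤP′]`, NO `P′` non-torsion (both derived: §2 + §1); the level `N′ = N_G` is derived from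
`hmod` (Carayol, tree). [cite: KrizLi2019, Thm. 1.16, Rem. 1.17] [cite: Darmon2004, Prop. 3.11 and §3.9]
[cite: GrossZagier1986, §V.2 (pp. 310–312)] [cite: Castella2018, proof of Thm. 2.3, (calcul) (arXiv:1704.06608 p. 6)] -/
theorem o5_index_unit_of_good_companion_trace
    (hKL : KrizLi2019.thm116_padicLogHeegner_congruence) (hmod : exists_isNewformOf)
    (W G : WeierstrassCurve ℚ) [W.IsElliptic] [W.IsGloballyMinimal] [G.IsElliptic] [G.IsGloballyMinimal]
    (hcong : ∀ ℓ : ℕ, ℓ.Prime → ¬ (ℓ ∣ 3 * W.conductorNorm ℤ * G.conductorNorm ℤ) →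
      ((W.LFunction ℓ : ℤ) : ZMod 3) = ((G.LFunction ℓ : ℤ) : ZMod 3))
    (hρ : W.HasSurjectiveModNGaloisRep 3) (hadd : Addv W 3)
    (hunitW : ∀ ℓ ∈ klSet W G, ℓ ≠ 3 → padicValInt 3 (nsCount W ℓ) = 0)
    (hunitG : ∀ ℓ ∈ klSet G W, ℓ ≠ 3 → padicValInt 3 (nsCount G ℓ) = 0)
    (htam : ¬ 3 ∣ W.tamagawaProduct) (hgoodG : G.HasGoodReductionAtPrime 3) (hw : G.rootNumber = -1)
    {N N' : ℕ} [NeZero N] [NeZero N'] (D : ModularParametrizationData W N)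
    (D' : ModularParametrizationData G N')
    (K : Type) [Field K] [NumberField K] (hK : IsImaginaryQuadratic K)
    {σ : K →ₐ[ℚ] K} (hσ : σ ≠ AlgHom.id ℚ K)
    (hH : SatisfiesHeegnerHypothesis N K) (hH' : SatisfiesHeegnerHypothesis N' K)
    (h3K : SatisfiesHeegnerHypothesis 3 K) (hd : NumberField.discr K < -4)
    (H : HeegnerDatum N (NumberField.discr K)) (H' : HeegnerDatum N' (NumberField.discr K))
    (ι : K →+* ℂ) (ι₃ : K →+* ℚ_[3])
    (P : (W.baseChange K).toAffine.Point) (P' Q : (G.baseChange K).toAffine.Point)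
    (hP : WeierstrassCurve.Affine.Point.map ι.toRatAlgHom P = heegnerPointComplex D H)
    (hP' : WeierstrassCurve.Affine.Point.map ι.toRatAlgHom P' = heegnerPointComplex D' H')
    (hPinf : ¬ IsOfFinAddOrder P) (hQ : ¬ IsOfFinAddOrder Q)
    (hQunit : X11b.padicLogOrd G 3 ι₃ Q + padicValInt 3 (nsCount G 3) - 1 = 0)
    {n : ℤ} (hn : ¬ (3 : ℤ) ∣ n)
    (hTr : IsOfFinAddOrder (P' + WeierstrassCurve.Affine.Point.map (W' := G) σ P' - n • Q))
    (hcD : padicValInt 3 D.maninConstant = 0) (hc3' : ¬ ((3 : ℤ) ∣ D'.maninConstant)) :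
    padicValNat 3 (AddSubgroup.zmultiples P).index = 0 := by
  haveI : Fact (Nat.Prime 3) := ⟨Nat.prime_three⟩
  -- the parametrisation level of the companion is its conductor (modularity + Carayol, tree)
  have hN' : N' = G.conductorNorm ℤ := IsNewformOf.level_eq_conductorNorm_of_exists_isNewformOf hmod D'.isNewformOf
  subst hN'
  -- §2: `2 • P′ − n • Q` torsion (Darmon Prop. 3.11 at sign −1); §1: `P′` non-torsion and 3-primitive
  have hrel : IsOfFinAddOrder ((2 : ℤ) • P' - n • Q) :=
    isOfFinAddOrder_two_zsmul_sub_of_trace G hK hH' ⟨D', H', ι, hP'⟩ hσ hw (n • Q) hTr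
  obtain ⟨hP'inf, hGunit⟩ :=
    companion_logUnit_of_trace_relation G hgoodG ι₃ P' Q hQ (by decide) hn hrel hQunit
  -- W side (GEN 16) with KL3-A := Kriz–Li Thm. 1.16 by name (part 14), as in 27b §1
  have h3d : ¬ ((3 : ℤ) ∣ NumberField.discr K) := not_three_dvd_discr_of_split K hK h3K
  have hcD' : padicValInt 3 D'.maninConstant = 0 := padicValInt.eq_zero_of_not_dvd hc3'
  have hWa3 : W.LFunction 3 = 0 :=
    W.LFunction_apply_eq_zero_of_not_good_of_not_mult 3 hadd.1 hadd.2 (dvd_refl 3)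
  have hNW : W.conductorNorm ℤ ≠ 0 := (W.conductorNorm_pos_holds).ne'
  have hNG : G.conductorNorm ℤ ≠ 0 := (G.conductorNorm_pos_holds).ne'
  exact padicValNat_index_eq_zero_of_companion_unit'
    (krizLiUnitBitTransportThree_of_thm116_of_exists_isNewformOf hKL hmod) W G hcong hρ hadd hWa3 hNW hNG
    hunitW hunitG htam D D' K hK hH hH' hd h3d H H' ι ι₃ P P' hP hP' hPinf hP'inf hcD hcD' hGunit

/-! ## §4 The `3`-primitive point a RATIONAL point with a KERNEL LADDER certificate (parts 12, 24, 27c) -/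

/-- **TRACE END, ladder form.** §3 with `Q := Q₀ ⊗ K` for a rational point `Q₀ = (x₀, y₀) ∈ G(ℚ)` whose
`3`-primitivity is a FINITE EXACT COMPUTATION: a ladder of chord/tangent steps (`Supersingular.ladderRunQ`,
`decide +kernel` per row) from `Q₀` to `m • Q₀ = (x_f, y_f)` (`m = qScalar 1 steps`), `ord₃ x_f = −2k`,
`0 < k`, and the numeral side condition `k − ord₃ m + ord₃ |G̃^{ns}(𝔽₃)| − 1 = 0` (part 24 core
`valuation_padicLog_of_nsmul_eq`: `Q₀` has infinite order and `ord₃ padicLog Q₀ = k − ord₃ m`). The trace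
relation reads `P′ + σ P′ ≡ n • (Q₀ ⊗ K) (mod torsion)`, `3 ∤ n` — census C's `Y = n · g₁ + t`.
[cite: SilvermanAEC2009, III.2.3, IV.6.4 and VII.2.2] [cite: KrizLi2019, Thm. 1.16, Rem. 1.17]
[cite: Darmon2004, Prop. 3.11 and §3.9] [cite: Castella2018, §2.2 and Thm. 2.3 (arXiv:1704.06608 p. 5)] -/
theorem o5_index_unit_of_good_companion_trace_ladder
    (hKL : KrizLi2019.thm116_padicLogHeegner_congruence) (hmod : exists_isNewformOf)
    (W G : WeierstrassCurve ℚ) [W.IsElliptic] [W.IsGloballyMinimal] [G.IsElliptic] [G.IsGloballyMinimal]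
    (hcong : ∀ ℓ : ℕ, ℓ.Prime → ¬ (ℓ ∣ 3 * W.conductorNorm ℤ * G.conductorNorm ℤ) →
      ((W.LFunction ℓ : ℤ) : ZMod 3) = ((G.LFunction ℓ : ℤ) : ZMod 3))
    (hρ : W.HasSurjectiveModNGaloisRep 3) (hadd : Addv W 3)
    (hunitW : ∀ ℓ ∈ klSet W G, ℓ ≠ 3 → padicValInt 3 (nsCount W ℓ) = 0)
    (hunitG : ∀ ℓ ∈ klSet G W, ℓ ≠ 3 → padicValInt 3 (nsCount G ℓ) = 0)
    (htam : ¬ 3 ∣ W.tamagawaProduct) (hgoodG : G.HasGoodReductionAtPrime 3) (hw : G.rootNumber = -1)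
    {N N' : ℕ} [NeZero N] [NeZero N'] (D : ModularParametrizationData W N)
    (D' : ModularParametrizationData G N')
    (K : Type) [Field K] [NumberField K] (hK : IsImaginaryQuadratic K)
    {σ : K →ₐ[ℚ] K} (hσ : σ ≠ AlgHom.id ℚ K)
    (hH : SatisfiesHeegnerHypothesis N K) (hH' : SatisfiesHeegnerHypothesis N' K)
    (h3K : SatisfiesHeegnerHypothesis 3 K) (hd : NumberField.discr K < -4)
    (H : HeegnerDatum N (NumberField.discr K)) (H' : HeegnerDatum N' (NumberField.discr K))
    (ι : K →+* ℂ) (ι₃ : K →+* ℚ_[3])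
    (P : (W.baseChange K).toAffine.Point) (P' : (G.baseChange K).toAffine.Point)
    (hP : WeierstrassCurve.Affine.Point.map ι.toRatAlgHom P = heegnerPointComplex D H)
    (hP' : WeierstrassCurve.Affine.Point.map ι.toRatAlgHom P' = heegnerPointComplex D' H')
    (hPinf : ¬ IsOfFinAddOrder P)
    {x₀ y₀ xf yf : ℚ} (h₀ : G.toAffine.Nonsingular x₀ y₀) (steps : List Supersingular.QStep)
    (hrun : Supersingular.ladderRunQ G.a₁ G.a₂ G.a₃ G.a₄ x₀ y₀ x₀ y₀ steps = some (xf, yf))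
    {k : ℕ} (hk : 0 < k) (hx : padicValRat 3 xf = -(2 * (k : ℤ)))
    (hmk : (k : ℤ) - padicValNat 3 (Supersingular.qScalar 1 steps) + padicValInt 3 (nsCount G 3) - 1 = 0)
    {n : ℤ} (hn : ¬ (3 : ℤ) ∣ n)
    (hTr : IsOfFinAddOrder (P' + WeierstrassCurve.Affine.Point.map (W' := G) σ P' -
      n • WeierstrassCurve.Affine.Point.map (W' := G.toAffine) (S := ℚ) (Algebra.ofId ℚ K) (.some x₀ y₀ h₀)))
    (hcD : padicValInt 3 D.maninConstant = 0) (hc3' : ¬ ((3 : ℤ) ∣ D'.maninConstant)) :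
    padicValNat 3 (AddSubgroup.zmultiples P).index = 0 := by
  haveI : Fact (Nat.Prime 3) := ⟨Nat.prime_three⟩
  obtain ⟨hf, hm⟩ := Supersingular.nsmul_some_eq_of_ladderRunQ h₀ steps hrun
  set Q₀ : G.toAffine.Point := .some x₀ y₀ h₀ with hQ₀def
  -- part 24 core: the ladder certificate ⇒ `Q₀` of infinite order with `ord₃ padicLog Q₀ = k − ord₃ m`
  have hm' : Supersingular.qScalar 1 steps • Affine.Point.map (W' := G.toAffine) (S := ℚ) (Algebra.ofId ℚ ℚ_[3]) Q₀ =
      Affine.Point.map (W' := G.toAffine) (S := ℚ) (Algebra.ofId ℚ ℚ_[3]) (.some xf yf hf) := by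
    rw [← map_nsmul]; exact congrArg _ hm
  rw [Affine.Point.map_some] at hm'
  have hx' : ((Algebra.ofId ℚ ℚ_[3]) xf).valuation = -(2 * (k : ℤ)) := by
    rw [show (Algebra.ofId ℚ ℚ_[3]) xf = (xf : ℚ_[3]) from eq_ratCast _ xf, Padic.valuation_ratCast, hx]
  obtain ⟨hnt, hval⟩ :=
    valuation_padicLog_of_nsmul_eq (G.baseChange ℚ_[3]) (by norm_num) hm' hk hx'
  have hQ₀ : ¬ IsOfFinAddOrder Q₀ := fun h =>
    hnt ((padicLog_eq_zero_iff (G.baseChange ℚ_[3]) _).mpr (AddMonoidHom.isOfFinAddOrder _ h))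
  have hQ : ¬ IsOfFinAddOrder (Affine.Point.map (W' := G.toAffine) (S := ℚ) (Algebra.ofId ℚ K) Q₀) :=
    not_isOfFinAddOrder_map_ofId G Q₀ hQ₀
  have hQunit : X11b.padicLogOrd G 3 ι₃ (Affine.Point.map (W' := G.toAffine) (S := ℚ) (Algebra.ofId ℚ K) Q₀) +
      padicValInt 3 (nsCount G 3) - 1 = 0 := by
    rw [padicLogOrd_map_ofId_eq_valuation_padicLog G 3 ι₃ Q₀ hQ₀, hval]; exact hmk
  exact o5_index_unit_of_good_companion_trace hKL hmod W G hcong hρ hadd hunitW hunitG htam hgoodG hw D D' K hK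
    hσ hH hH' h3K hd H H' ι ι₃ P P' _ hP hP' hPinf hQ hQunit hn hTr hcD hc3'

/-! ## §5 The same END in ANALYTIC-RANK currency (Gross–Zagier by name; as part 28) -/

/-- **TRACE END, ladder form, analytic currency.** §4 with `hPinf` supplied by the Gross–Zagier formula BY NAME
(`gross_zagier N W K`) + `ord_{s=1} L(W/K, s) = 1` (tree: `analyticRankEK_eq_one_iff_heegner_nonTorsion_of_exists_isNewformOf`),
and the sign `w(G) = −1` supplied by `ord_{s=1} L(G, s) = 1` (§2). Conditional theorem; research route; O5 OPEN;
nothing booked. [cite: GrossZagier1986, Thm. I.6.3 with V.§2] [cite: KrizLi2019, Thm. 1.16, Rem. 1.17]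
[cite: Darmon2004, Prop. 3.11 and §3.9] [cite: SilvermanAEC2009, C.16 Thm. 16.3 (p. 451)] -/
theorem o5_index_unit_of_good_companion_trace_ladder_analytic
    (hKL : KrizLi2019.thm116_padicLogHeegner_congruence) (hmod : exists_isNewformOf)
    (W G : WeierstrassCurve ℚ) [W.IsElliptic] [W.IsGloballyMinimal] [G.IsElliptic] [G.IsGloballyMinimal]
    (hcong : ∀ ℓ : ℕ, ℓ.Prime → ¬ (ℓ ∣ 3 * W.conductorNorm ℤ * G.conductorNorm ℤ) →
      ((W.LFunction ℓ : ℤ) : ZMod 3) = ((G.LFunction ℓ : ℤ) : ZMod 3))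
    (hρ : W.HasSurjectiveModNGaloisRep 3) (hadd : Addv W 3)
    (hunitW : ∀ ℓ ∈ klSet W G, ℓ ≠ 3 → padicValInt 3 (nsCount W ℓ) = 0)
    (hunitG : ∀ ℓ ∈ klSet G W, ℓ ≠ 3 → padicValInt 3 (nsCount G ℓ) = 0)
    (htam : ¬ 3 ∣ W.tamagawaProduct) (hgoodG : G.HasGoodReductionAtPrime 3) (hanG : G.analyticRank = 1)
    {N N' : ℕ} [NeZero N] [NeZero N'] (D : ModularParametrizationData W N)
    (D' : ModularParametrizationData G N')
    (K : Type) [Field K] [NumberField K] (hK : IsImaginaryQuadratic K) (hGZW : gross_zagier N W K)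
    {σ : K →ₐ[ℚ] K} (hσ : σ ≠ AlgHom.id ℚ K)
    (hH : SatisfiesHeegnerHypothesis N K) (hH' : SatisfiesHeegnerHypothesis N' K)
    (h3K : SatisfiesHeegnerHypothesis 3 K) (hd : NumberField.discr K < -4)
    (H : HeegnerDatum N (NumberField.discr K)) (H' : HeegnerDatum N' (NumberField.discr K))
    (ι : K →+* ℂ) (ι₃ : K →+* ℚ_[3])
    (P : (W.baseChange K).toAffine.Point) (P' : (G.baseChange K).toAffine.Point)
    (hP : WeierstrassCurve.Affine.Point.map ι.toRatAlgHom P = heegnerPointComplex D H)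
    (hP' : WeierstrassCurve.Affine.Point.map ι.toRatAlgHom P' = heegnerPointComplex D' H')
    (han : analyticRankEK W K = 1)
    {x₀ y₀ xf yf : ℚ} (h₀ : G.toAffine.Nonsingular x₀ y₀) (steps : List Supersingular.QStep)
    (hrun : Supersingular.ladderRunQ G.a₁ G.a₂ G.a₃ G.a₄ x₀ y₀ x₀ y₀ steps = some (xf, yf))
    {k : ℕ} (hk : 0 < k) (hx : padicValRat 3 xf = -(2 * (k : ℤ)))
    (hmk : (k : ℤ) - padicValNat 3 (Supersingular.qScalar 1 steps) + padicValInt 3 (nsCount G 3) - 1 = 0)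
    {n : ℤ} (hn : ¬ (3 : ℤ) ∣ n)
    (hTr : IsOfFinAddOrder (P' + WeierstrassCurve.Affine.Point.map (W' := G) σ P' -
      n • WeierstrassCurve.Affine.Point.map (W' := G.toAffine) (S := ℚ) (Algebra.ofId ℚ K) (.some x₀ y₀ h₀)))
    (hcD : padicValInt 3 D.maninConstant = 0) (hc3' : ¬ ((3 : ℤ) ∣ D'.maninConstant)) :
    padicValNat 3 (AddSubgroup.zmultiples P).index = 0 :=
  o5_index_unit_of_good_companion_trace_ladder hKL hmod W G hcong hρ hadd hunitW hunitG htam hgoodG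
    (rootNumber_eq_neg_one_of_analyticRank_eq_one hmod G hanG) D D' K hK hσ hH hH' h3K hd H H' ι ι₃ P P' hP hP'
    ((analyticRankEK_eq_one_iff_heegner_nonTorsion_of_exists_isNewformOf W N K hGZW hmod hK
      (IsNewformOf.level_eq_conductorNorm_of_exists_isNewformOf hmod D.isNewformOf).symm hH ⟨D, H, ι, hP⟩).mp han)
    h₀ steps hrun hk hx hmk hn hTr hcD hc3'

end Summit.BirchSwinnertonDyer.Rank1Residual.O5.HeegnerLogTransport

end
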